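import Literature.AlgebraicGeometry.HodgeTheory.CyclicCoverUniversalFamily
import Literature.AlgebraicGeometry.HodgeTheory.UniversalHypersurfaceEhresmann
import Literature.AlgebraicGeometry.HodgeTheory.HypersurfaceComplexPoints
import Literature.AlgebraicGeometry.HodgeTheory.GlobalInvariantCyclesProofs
import Literature.AlgebraicGeometry.Motives.MonomialSupportedHypersurfaceSymmetry
import Literature.AlgebraicGeometry.Motives.AlgPointsProperMapProofs
import Literature.NumberTheory.Transcendental.ProjectiveSpaceT2Proofs
import HarnessLib

/-!
# Homogeneous coordinates on the total space of the Carlson–Toledo family of cyclic covers: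
# `𝒴(ℂ) ≅ {([z], t) | z₃^p = f_t(z₀, z₁, z₂)} ⊂ ℙ(ℂ⁴) × S(ℂ)` (Carlson–Toledo 1999 §2, (universalcyclic))

Family `hodge`, layer `Literature/AlgebraicGeometry/HodgeTheory`; theorems only (no definition, no named fact).
Written by the prover seat `hodge-nonav-prover-Bx` (g8) for the route `CyclicUnitaryPowers` of the Hodge summit:
the point-set presentation of the total space `𝒴 = cyclicCoverTotal p` of the CONSTRUCTED universal family
`u = cyclicCoverFamily p : 𝒴 ⟶ S` (`CyclicCoverUniversalFamily`) needed to write down continuous fibrewise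
isotopies of the family (e.g. `x₃ ↦ e^{2πit/p} x₃` over the scalar loop `t ↦ e^{2πit} f`, whose holonomy is the deck
transformation — `DirectImageIsotopy`).

Let `Θ(P) = ([z](P), u(P))`, where `[z] : 𝒴(ℂ) → ℙ(ℂ⁴)` is the homogeneous-coordinate map of
`𝒴 → 𝒴_U → ℙ³` (`hypersurfacePoint`, `HypersurfaceComplexPoints`).

* §1 `exists_fiberIso_comp_hypersurfaceι_spz` — the fibre of `u` over `t` is the model `X_{F_t}`,
  `F_t = x₃^p − f_t`, COMPATIBLY WITH THE EMBEDDINGS into `ℙ³` (base change of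
  `Motives.UniversalHypersurface.exists_fiberIso_comp_hypersurfaceι`); `hypersurfacePoint_comp` — functoriality
  of homogeneous coordinates; hence `hypersurfacePoint_map_fiberι` — the coordinates of a point of the fibre
  are those of the corresponding point of the model.
* §2 `coords_mem_projZeroLocus` — every point of `𝒴(ℂ)` over `t` has coordinates in `V(F_t) ⊂ ℙ(ℂ⁴)`;
  `eq_of_coords_eq_of_map_eq` — **`Θ` is injective**; `exists_point_of_mem_projZeroLocus` — **every `([z], t)`
  with `F_t(z) = 0` is `Θ(P)`** (the printed "`𝐘 = {(x, y, a) : y^k + Σ a_L x^L = 0}`").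
* §3 `isClosedEmbedding_coords_prod_map` — **`Θ` is a closed topological embedding** (`u(ℂ)` is a proper map,
  `Motives.AlgPoints.isProperMap_map`; the graph of the continuous `[z]` is closed).

## References

* [CarlsonToledo1999] J. A. Carlson, D. Toledo, Duke Math. J. 97 (1999), §2 (universalcyclic) (held text p0004).
* [SerreGAGA1956] J.-P. Serre, GAGA, §2 n°5 (the analytic topology of complex points; closed immersions).
* [VoisinHodgeII2003] C. Voisin, Hodge Theory and Complex Algebraic Geometry II, §6.2.1 (the universal family).
-/

noncomputable section

namespace Literature.AlgebraicGeometry.HodgeTheory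

open CategoryTheory _root_.AlgebraicGeometry _root_.Topology
open scoped LinearAlgebra.Projectivization
open Literature.AlgebraicGeometry.Motives Literature.AlgebraicGeometry.Motives.UniversalHypersurface
open Literature.AlgebraicGeometry.HodgeTheory.UniversalHypersurface

/-! ### §1 Fibres versus models, compatibly with the embeddings into `ℙ³` -/

section Fibre

variable (p : ℕ) [NeZero p]

/-- **The fibre of the Carlson–Toledo family over `t` is the hypersurface of any form `G = F_t`, compatibly with
the embeddings into `ℙ³`**: there is `e : 𝒴_t ≅ X_G` with `e ≫ (X_G ↪ ℙ³) = (𝒴_t → 𝒴 → 𝒴_U → ℙ³)` (base change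
of `exists_fiberIso_comp_hypersurfaceι`; the equation `F_t = G` is substituted).
[cite: CarlsonToledo1999, §2 (universalcyclic) (held text p0004)] [cite: VoisinHodgeII2003, §6.2.1] -/
theorem exists_fiberIso_comp_hypersurfaceι_spz (t : ComplexPoints (cyclicCoverBase p))
    {G : MvPolynomial (Fin 4) ℂ} (hG : pointFormSpz ℂ 2 p (cyclicCoverSpz p) t = G) :
    ∃ e : fiberOver (cyclicCoverFamily p) t ≅ SmoothHypersurface.hypersurface G,
      e.hom ≫ SmoothHypersurface.hypersurfaceι G =
        fiberι (cyclicCoverFamily p) t ≫ totalSpzToTotal ℂ 2 p (cyclicCoverSpz p) ≫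
          UniversalHypersurface.toProjectiveSpace ℂ 2 p := by
  subst hG
  have hp : 0 < p := Nat.pos_of_ne_zero (NeZero.ne p)
  obtain ⟨e₀, he₀⟩ := exists_fiberIso_comp_hypersurfaceι ℂ 2 p hp
    (AlgPoints.map (toBaseSpz ℂ 2 p (cyclicCoverSpz p)) t)
  refine ⟨fiberOverFamilyPullbackIso (family ℂ 2 p) (toBaseSpz ℂ 2 p (cyclicCoverSpz p)) t ≪≫ e₀, ?_⟩
  have h1 := fiberOverFamilyPullbackIso_hom_fiberι (family ℂ 2 p) (toBaseSpz ℂ 2 p (cyclicCoverSpz p)) t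
  rw [Iso.trans_hom, Category.assoc, he₀, ← Category.assoc]
  change ((fiberOverFamilyPullbackIso (family ℂ 2 p) (toBaseSpz ℂ 2 p (cyclicCoverSpz p)) t).hom ≫
      fiberι (family ℂ 2 p) (AlgPoints.map (toBaseSpz ℂ 2 p (cyclicCoverSpz p)) t)) ≫ _ =
    fiberι (familyPullback.snd (family ℂ 2 p) (toBaseSpz ℂ 2 p (cyclicCoverSpz p))) t ≫
      familyPullback.fst (family ℂ 2 p) (toBaseSpz ℂ 2 p (cyclicCoverSpz p)) ≫ _
  rw [h1, Category.assoc]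

end Fibre

/-! ### §2 Homogeneous coordinates on the total space -/

section Coords

variable {n : ℕ} {Y Y' : SchemeOver ℂ}

/-- **Functoriality of homogeneous coordinates**: the coordinates of `P ∈ Y'(ℂ)` for `g ≫ ι : Y' → ℙⁿ⁺¹` are
those of `g(P)` for `ι`. [cite: SerreGAGA1956, §2 n°5] -/
theorem hypersurfacePoint_comp (g : Y' ⟶ Y) (ι : Y ⟶ projectiveSpace (n + 1) ℂ) (P : ComplexPoints Y') :
    hypersurfacePoint (g ≫ ι) P = hypersurfacePoint ι (AlgPoints.map g P) :=
  hypersurfacePoint_eq_of_projPoint_eq _ _ (by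
    rw [projPoint_hypersurfacePoint, AlgPoints.map_comp, Function.comp_apply])

variable (p : ℕ)

/-- **The coordinates of a point of the fibre are those of the corresponding point of the model**: for an
identification `e : 𝒴_t ≅ X_G` compatible with the embeddings into `ℙ³` and `Q ∈ 𝒴_t(ℂ)`,
`[z](ι_t Q) = [z]_{X_G}(e Q)`. [cite: CarlsonToledo1999, §2 (universalcyclic) (held text p0004)] -/
theorem hypersurfacePoint_map_fiberι {t : ComplexPoints (cyclicCoverBase p)} {G : MvPolynomial (Fin 4) ℂ}
    (e : fiberOver (cyclicCoverFamily p) t ≅ SmoothHypersurface.hypersurface G)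
    (he : e.hom ≫ SmoothHypersurface.hypersurfaceι G =
      fiberι (cyclicCoverFamily p) t ≫ totalSpzToTotal ℂ 2 p (cyclicCoverSpz p) ≫
        UniversalHypersurface.toProjectiveSpace ℂ 2 p)
    (Q : ComplexPoints (fiberOver (cyclicCoverFamily p) t)) :
    hypersurfacePoint (totalSpzToTotal ℂ 2 p (cyclicCoverSpz p) ≫ UniversalHypersurface.toProjectiveSpace ℂ 2 p)
        (AlgPoints.map (fiberι (cyclicCoverFamily p) t) Q) =
      hypersurfacePoint (SmoothHypersurface.hypersurfaceι G) (AlgPoints.map e.hom Q) := by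
  rw [← hypersurfacePoint_comp, ← hypersurfacePoint_comp, he]

/-- **Every point of `𝒴(ℂ)` lies on the model of its base point**: the coordinates of `P ∈ 𝒴(ℂ)` are a
projective zero of `F_{u(P)} = x₃^p − f_{u(P)}`. [cite: CarlsonToledo1999, §2 (universalcyclic) (held text p0004)] -/
theorem coords_mem_projZeroLocus [NeZero p] (P : ComplexPoints (cyclicCoverTotal p)) :
    hypersurfacePoint (totalSpzToTotal ℂ 2 p (cyclicCoverSpz p) ≫ UniversalHypersurface.toProjectiveSpace ℂ 2 p) P ∈
      Projectivization.projZeroLocus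
        {pointFormSpz ℂ 2 p (cyclicCoverSpz p) (AlgPoints.map (cyclicCoverFamily p) P)} := by
  generalize ht : AlgPoints.map (cyclicCoverFamily p) P = t
  obtain ⟨Q, rfl⟩ : P ∈ Set.range (AlgPoints.map (fiberι (cyclicCoverFamily p) t)) := by
    rw [AlgPoints.range_map_fiberι]; exact ht
  obtain ⟨e, he⟩ := exists_fiberIso_comp_hypersurfaceι_spz p t rfl
  have hmem := hypersurfacePoint_mem_projZeroLocus
    (ι := SmoothHypersurface.hypersurfaceι (pointFormSpz ℂ 2 p (cyclicCoverSpz p) t))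
    (isHomogeneous_pointForm ℂ 2 p _) (SmoothHypersurface.range_hypersurfaceι _) (AlgPoints.map e.hom Q)
  rw [hypersurfacePoint_map_fiberι p e he]
  exact hmem

/-- **`Θ = ([z], u)` is injective on `𝒴(ℂ)`**: two points over the same `t` with the same coordinates are
equal (both come from the fibre `𝒴_t ≅ X_{F_t} ↪ ℙ³`, and `X_{F_t}(ℂ) → ℙ(ℂ⁴)` is injective).
[cite: CarlsonToledo1999, §2 (universalcyclic) (held text p0004)] [cite: SerreGAGA1956, §2 n°5 Lemme 1 b)] -/
theorem eq_of_coords_eq_of_map_eq [NeZero p] {P P' : ComplexPoints (cyclicCoverTotal p)}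
    (hc : hypersurfacePoint (totalSpzToTotal ℂ 2 p (cyclicCoverSpz p) ≫
        UniversalHypersurface.toProjectiveSpace ℂ 2 p) P =
      hypersurfacePoint (totalSpzToTotal ℂ 2 p (cyclicCoverSpz p) ≫
        UniversalHypersurface.toProjectiveSpace ℂ 2 p) P')
    (ht : AlgPoints.map (cyclicCoverFamily p) P = AlgPoints.map (cyclicCoverFamily p) P') : P = P' := by
  generalize ht' : AlgPoints.map (cyclicCoverFamily p) P = t at ht
  obtain ⟨Q, rfl⟩ : P ∈ Set.range (AlgPoints.map (fiberι (cyclicCoverFamily p) t)) := by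
    rw [AlgPoints.range_map_fiberι]; exact ht'
  obtain ⟨Q', rfl⟩ : P' ∈ Set.range (AlgPoints.map (fiberι (cyclicCoverFamily p) t)) := by
    rw [AlgPoints.range_map_fiberι]; exact ht.symm
  obtain ⟨e, he⟩ := exists_fiberIso_comp_hypersurfaceι_spz p t rfl
  rw [hypersurfacePoint_map_fiberι p e he, hypersurfacePoint_map_fiberι p e he] at hc
  have hinj := (isEmbedding_hypersurfacePoint (SmoothHypersurface.hypersurfaceι
    (pointFormSpz ℂ 2 p (cyclicCoverSpz p) t))).injective hc
  have hQ : Q = Q' := by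
    have h := congrArg (AlgPoints.map e.inv) hinj
    rw [← AlgPoints.map_comp_apply, ← AlgPoints.map_comp_apply, Iso.hom_inv_id, AlgPoints.map_id] at h
    exact h
  rw [hQ]

/-- **Every projective zero of `F_t` is the coordinate vector of a point of `𝒴(ℂ)` over `t`** (the printed
description "`𝐘 = {(x, y, a) : y^k + Σ a_L x^L = 0}`" of the total space on points).
[cite: CarlsonToledo1999, §2 (universalcyclic) (held text p0004)] [cite: SerreGAGA1956, §2 n°5] -/
theorem exists_point_of_mem_projZeroLocus [NeZero p] (t : ComplexPoints (cyclicCoverBase p)) {ℓ : ℙ ℂ (Fin 4 → ℂ)}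
    (hℓ : ℓ ∈ Projectivization.projZeroLocus {pointFormSpz ℂ 2 p (cyclicCoverSpz p) t}) :
    ∃ P : ComplexPoints (cyclicCoverTotal p), AlgPoints.map (cyclicCoverFamily p) P = t ∧
      hypersurfacePoint (totalSpzToTotal ℂ 2 p (cyclicCoverSpz p) ≫
        UniversalHypersurface.toProjectiveSpace ℂ 2 p) P = ℓ := by
  obtain ⟨e, he⟩ := exists_fiberIso_comp_hypersurfaceι_spz p t rfl
  obtain ⟨Q', hQ'⟩ := exists_hypersurfacePoint_eq (ι := SmoothHypersurface.hypersurfaceι _)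
    (isHomogeneous_pointForm ℂ 2 p _) (SmoothHypersurface.range_hypersurfaceι _) hℓ
  refine ⟨AlgPoints.map (fiberι (cyclicCoverFamily p) t) (AlgPoints.map e.inv Q'),
    AlgPoints.map_map_fiberι _ _ _, ?_⟩
  rw [hypersurfacePoint_map_fiberι p e he, ← AlgPoints.map_comp_apply, Iso.inv_hom_id, AlgPoints.map_id]
  exact hQ'

end Coords

/-! ### §3 `Θ` is a closed embedding -/

section Embedding

variable (p : ℕ) [NeZero p]

/-- `u(ℂ) : 𝒴(ℂ) → S(ℂ)` is a proper map (`u` is proper). [cite: SerreGAGA1956, §2 n°5] -/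
theorem isProperMap_map_cyclicCoverFamily :
    IsProperMap (AlgPoints.map (cyclicCoverFamily p) : ComplexPoints (cyclicCoverTotal p) → _) := by
  haveI : IsProper (cyclicCoverFamily p).left := (isSmoothProjectiveFamily_cyclicCoverFamily p).isProper
  haveI : UniversallyClosed (cyclicCoverFamily p).left := IsProper.toUniversallyClosed
  haveI : QuasiCompact (cyclicCoverFamily p).left := inferInstance
  exact AlgPoints.isProperMap_map (cyclicCoverFamily p)

/-- **`Θ = ([z], u) : 𝒴(ℂ) → ℙ(ℂ⁴) × S(ℂ)` is a closed topological embedding**: continuous, injective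
(`eq_of_coords_eq_of_map_eq`) and closed (the graph of `[z]` is closed and `id × u(ℂ)` is a closed map, `u(ℂ)`
being proper). Hence `𝒴(ℂ)` is homeomorphic to the incidence set `{([z], t) | F_t(z) = 0}`.
[cite: CarlsonToledo1999, §2 (universalcyclic) (held text p0004)] [cite: SerreGAGA1956, §2 n°5 Lemme 1 b)] -/
theorem isClosedEmbedding_coords_prod_map :
    IsClosedEmbedding fun P : ComplexPoints (cyclicCoverTotal p) =>
      (hypersurfacePoint (totalSpzToTotal ℂ 2 p (cyclicCoverSpz p) ≫
          UniversalHypersurface.toProjectiveSpace ℂ 2 p) P,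
        AlgPoints.map (cyclicCoverFamily p) P) := by
  haveI : T2Space (ℙ ℂ (Fin 4 → ℂ)) := Projectivization.t2Space_pi
  have hc := continuous_hypersurfacePoint (totalSpzToTotal ℂ 2 p (cyclicCoverSpz p) ≫
    UniversalHypersurface.toProjectiveSpace ℂ 2 p)
  have hπ := AlgPoints.continuous_map (L := ℂ) (cyclicCoverFamily p)
  refine IsClosedEmbedding.of_continuous_injective_isClosedMap (hc.prodMk hπ)
    (fun P P' h => eq_of_coords_eq_of_map_eq p (congrArg Prod.fst h) (congrArg Prod.snd h)) ?_
  -- `Θ = (id × u(ℂ)) ∘ graph([z])`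
  intro C hC
  have hgraph : IsClosed ((fun P : ComplexPoints (cyclicCoverTotal p) =>
      (hypersurfacePoint (totalSpzToTotal ℂ 2 p (cyclicCoverSpz p) ≫
        UniversalHypersurface.toProjectiveSpace ℂ 2 p) P, P)) '' C) := by
    have hce : IsClosedEmbedding fun P : ComplexPoints (cyclicCoverTotal p) =>
        (hypersurfacePoint (totalSpzToTotal ℂ 2 p (cyclicCoverSpz p) ≫
          UniversalHypersurface.toProjectiveSpace ℂ 2 p) P, P) :=
      IsClosedEmbedding.of_continuous_injective_isClosedMap (hc.prodMk continuous_id)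
        (fun P P' h => congrArg Prod.snd h) (by
          intro D hD
          have : (fun P : ComplexPoints (cyclicCoverTotal p) =>
              (hypersurfacePoint (totalSpzToTotal ℂ 2 p (cyclicCoverSpz p) ≫
                UniversalHypersurface.toProjectiveSpace ℂ 2 p) P, P)) '' D =
              {x | x.1 = hypersurfacePoint (totalSpzToTotal ℂ 2 p (cyclicCoverSpz p) ≫
                UniversalHypersurface.toProjectiveSpace ℂ 2 p) x.2} ∩ Prod.snd ⁻¹' D := by
            ext x
            obtain ⟨a, b⟩ := x
            constructor
            · rintro ⟨P, hP, h⟩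
              rw [Prod.mk.injEq] at h
              obtain ⟨rfl, rfl⟩ := h
              exact ⟨rfl, hP⟩
            · rintro ⟨h1, h2⟩
              exact ⟨b, h2, Prod.ext h1.symm rfl⟩
          rw [this]
          exact (isClosed_eq continuous_fst (hc.comp continuous_snd)).inter (hD.preimage continuous_snd))
    exact hce.isClosedMap C hC
  have hprop : IsProperMap (Prod.map (id : ℙ ℂ (Fin 4 → ℂ) → ℙ ℂ (Fin 4 → ℂ))
      (AlgPoints.map (cyclicCoverFamily p) : ComplexPoints (cyclicCoverTotal p) → _)) :=
    isProperMap_id.prodMap (isProperMap_map_cyclicCoverFamily p)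
  have heq : (fun P : ComplexPoints (cyclicCoverTotal p) =>
      (hypersurfacePoint (totalSpzToTotal ℂ 2 p (cyclicCoverSpz p) ≫
          UniversalHypersurface.toProjectiveSpace ℂ 2 p) P,
        AlgPoints.map (cyclicCoverFamily p) P)) '' C =
      Prod.map id (AlgPoints.map (cyclicCoverFamily p)) '' ((fun P : ComplexPoints (cyclicCoverTotal p) =>
        (hypersurfacePoint (totalSpzToTotal ℂ 2 p (cyclicCoverSpz p) ≫
          UniversalHypersurface.toProjectiveSpace ℂ 2 p) P, P)) '' C) := by
    rw [Set.image_image]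
    rfl
  rw [heq]
  exact hprop.isClosedMap _ hgraph

end Embedding

end Literature.AlgebraicGeometry.HodgeTheory

end
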